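import Summits.BirchSwinnertonDyer.BirchSwinnertonDyer.Theorems.QuadraticBranchSignedControlPlusEtaLowerInclusionTamagawaRoadCount
import Summits.BirchSwinnertonDyer.BirchSwinnertonDyer.Theorems.QuadraticBranchSignedControlPlusEtaLowerInclusionTamagawaRoadDuality
import Summits.BirchSwinnertonDyer.BirchSwinnertonDyer.Theorems.QuadraticBranchSignedControlPlusEtaLowerInclusionValuationSqueezeTorsion
import Literature.NumberTheory.EllipticCurves.KatoRankBoundProofs
import Literature.NumberTheory.EllipticCurves.IwasawaCoinvariantsRankProofs
import HarnessLib

/-!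
# Route `QuadraticBranchSignedControl` (rung K8, cell `bsd-potss`), crux `PlusEtaLowerInclusion`
# (item stmt-BirchSwinnertonDyer-19601): THE TAMAGAWA ROAD — (E⁺_η) at a tower-onto pair of ANY rank
# `r` from the named facts, Poitou–Tate, the certificates and **`v + r ≤ ord_p Tam(W)`** when every
# local Tamagawa number of `W` has `ord_p ≤ 1` (seat `bsd-potss-k8eta-c1` g4; g3's memo §D executed)

WHAT. g3's valuation squeeze (p499967 … p507131) left (E⁺_η) at a tower-onto pair equivalent to ONE
divisibility `p^v ∣ #(X_η/TX_η)_tors` (p505261), with the analytic certificate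
`p^{v+1} ∤ coeff_r L_p⁺(V,η,T)`. THIS FILE supplies that divisibility from the TAMAGAWA NUMBERS of the
`p*`-partner `W`:

* §1 `pow_dvd_natCard_torsion_coinvariants_of_namedFacts_of_poitouTate_of_tamagawa` — GRANTED
  Kobayashi's Thm. 1.2 / 1.3 / 2.2(η) / 4.1(η) (NAMED facts), `poitouTate_selmerStructure_duality_real ℚ`
  (NAMED fact), on a good `a_p = 0` pair with `p ≥ 5`, `ρ_{V,p^m}` onto, the `V`-certificate and
  `coeff_r L_p⁺(V,η,T) ≠ 0`; for the `p*`-partner `W` (`C • W.quadraticTwist ((−1)^{p/2} p) = V`) and a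
  finite set `T ∌ (p)` of places containing every `ℓ ≠ p` with `p ∣ c_ℓ(W)` and such that
  `ord_p c_ℓ(W) ≤ 1` on `T`: for EVERY `η`-datum `D`,
  **`p^v ∣ #(D.X/T·D.X)_tors` whenever `v + r ≤ ∑_{ℓ ∈ T} ord_p c_ℓ(W)`** (`r = rank V^{(p*)}(ℚ)`).
  Chain (all kernel theorems): `∏_T p^{ord_p c_ℓ} ∣ #Sel^{loc,∞,+}(W/ℚ)[p]` (part 1, Poitou–Tate at
  level `p`) `= #Sel⁺(W/ℚ_∞)^Γ[p]` (part 2 §4, `h₀`) `≤ p^{rank_{ℤ_p}(D.X/T)} · #(D.X/T)_tors` (part 2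
  §1 + §3: `D.X/T·D.X ≅ Hom(Sel⁺(W/ℚ_∞)^Γ, ℚ/ℤ)`) with `rank_{ℤ_p}(D.X/T) = r` (g3's `T`-semisimplicity,
  p502879) and `#(D.X/T)_tors = p^j`; so `∑ ord_p c_ℓ ≤ r + j`.
* §2 **`quadraticBranchPlusEtaLowerInclusionAt_of_namedFacts_of_certV_of_poitouTate_of_tamagawa`** —
  (E⁺_η)(V, p) from the named facts + `hPT` + tower onto + `V`-certificate + the analytic certificate
  `p^{v+1} ∤ coeff_r L_p⁺(V,η,T)` with **`v + r ≤ ∑_{ℓ ∈ T} ord_p c_ℓ(W)`**, `ord_p c_ℓ(W) ≤ 1` on `T`.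
  READING (g3's census, HOME/k8eta-c1/ETALEAD-TABLE-k8eta-c1-g3.tsv): on the 13 rank-one tower-onto
  rows with `v_an = 1` and exactly two Tamagawa-`5` primes `5 ∥ c_ℓ` (125400cx1, 150150ei1, 174450d1,
  209550a1, 225150k1, 311850cf1, 33150cf1, 345450go1, 36075p1, 366450bp1, 460950m1, 48300w1, 77350bi1)
  the arithmetic input holds with `v = 1 = v_an` (`∑ = 2`, `r = 1`); the remaining per-row inputs are
  the NAMED facts and the analytic certificate `25 ∤ coeff₁ L_p⁺(V,η,T)` (kit evidence, not kernel).

HONEST FRAMING (cell `bsd-potss`, run/shared/lean/pub/bsd-potss/; FULL-BSD rank ≤ 1 programme, HUMAN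
RULING D-0036/D-0074): TOOL THEOREMS ONLY, CONDITIONAL on the named Literature facts in hypothesis
position (Kobayashi 2003 Thm. 1.2/1.3/2.2η/4.1η, Kitajima–Otsuki 2018 Thm. 1.3 at `η`, Milne I.4.10 =
`poitouTate_selmerStructure_duality_real ℚ`), on the tower-onto hypothesis, the `V`-certificate, the
analytic certificate (supplied here for NO pair) and the DISPLAYED Tamagawa inequality. The crux 19601
(class-wide Eisenstein inclusion at `η`) is OPEN and NOT closed; no row is certified in the kernel by
this file; nothing is booked; `BSD(W, p)` is claimed for no pair. No definition, no named fact minted,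
no `sorry`, axioms standard. `--supports stmt-BirchSwinnertonDyer-19601`.

References: [Kobayashi2003] Thm. 2.2 (p. 5), §4 + Thm. 4.1 (p. 8), Thm. 9.3 with (9.33) (pp. 26–27);
[KitajimaOtsuki2018] Thm. 1.3; [MilneADT2006] I Thm. 4.10; [GreenbergLNM1716] §3–§4;
[CoatesSchneiderSujatha2003] §3 (30)–(31); [PerrinRiou1993] (shape of `v_an = ord Ш + ord Tam + …`, not used).
-/

set_option autoImplicit false
set_option linter.dupNamespace false

noncomputable section

open scoped Classical AddSubgroup

open CongruenceSubgroup Field NumberField IsDedekindDomain WeierstrassCurve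
open Literature.NumberTheory.EllipticCurves
open Literature.NumberTheory.EllipticCurves.ModularForms
open Literature.NumberTheory.GaloisRepresentations
open Literature.NumberTheory.GaloisCohomology
open Literature.NumberTheory.EllipticCurves.IwasawaDual
open Literature.NumberTheory.EllipticCurves.IwasawaAlgebra
open Summit.BirchSwinnertonDyer.Rank1Residual.Additive

namespace Summit.BirchSwinnertonDyer.BirchSwinnertonDyer.Theorems

variable {V : WeierstrassCurve ℚ} [V.IsElliptic] [V.IsGloballyMinimal] {p : ℕ} [hp : Fact p.Prime]

/-! ## §1 `p^v ∣ #(X_η/TX_η)_tors` from the Tamagawa numbers of `W` -/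

/-- **`p^v ∣ #(X_η/TX_η)_tors` whenever `v + r ≤ ∑_{ℓ ∈ T} ord_p c_ℓ(W)`** at a tower-onto pair of
rank `r = rank V^{(p*)}(ℚ)` (see the module docstring, §1). CONDITIONAL on the named facts
(`h12 h13 h22 h41`, `hPT`), tower onto, the `V`-certificate, `coeff_r L_p⁺(V,η,T) ≠ 0`, and
`ord_p c_ℓ(W) ≤ 1` on `T`. [cite: Kobayashi2003, Thm. 2.2 (p. 5), Thm. 4.1 (p. 8), Thm. 9.3 (pp. 26–27)]
[cite: MilneADT2006, Ch. I, Thm. 4.10] [cite: GreenbergLNM1716, §3 Lemma 3.1–3.3, §4 Thm. 4.1]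
[cite: CoatesSchneiderSujatha2003, §3 (30)–(31)] -/
theorem pow_dvd_natCard_torsion_coinvariants_of_namedFacts_of_poitouTate_of_tamagawa
    (h12 : Kobayashi2003.thm12_signedSelmerDual_finite_torsion)
    (h13 : Kobayashi2003.thm41_signedCharIdeal_divisibility)
    (h22 : Kobayashi2003.thm22_etaSignedSelmerDual_finite_torsion)
    (h41 : Kobayashi2003.thm41_plusEtaCharIdeal_dvd)
    (hPT : poitouTate_selmerStructure_duality_real ℚ)
    (hp5 : 5 ≤ p) (hgood : V.HasGoodReductionAtPrime p) (hap : V.frobeniusTrace p = 0)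
    (hsurj : ∀ m : ℕ, V.HasSurjectiveModNGaloisRep (p ^ m : ℕ))
    (hcertV : ∀ {N : ℕ} [NeZero N] (f : CuspForm (Gamma0 N) 2), IsNewformOf V f →
      ∃ L : IwasawaAlgebra p, Kobayashi2003.IsSignedPAdicLFunction f p 1 L ∧
        IsUnit (PowerSeries.coeff V.mordellWeilRank L))
    {N : ℕ} [NeZero N] {f : CuspForm (Gamma0 N) 2} (hf : IsNewformOf V f) (ϖ : ℚ)
    (hϖ : if Even (p / 2) then (ϖ : ℝ) * V.realPeriodRat = plusPeriod f
      else (ϖ : ℝ) * V.imaginaryPeriodRat = minusPeriod f)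
    (Lη : IwasawaAlgebra p) (hL : IsQuadraticBranchPlusLFunction f p ϖ Lη)
    (hne : PowerSeries.coeff (V.quadraticTwist ((-1) ^ (p / 2) * p)).mordellWeilRank Lη ≠ 0)
    (W : WeierstrassCurve ℚ) [W.IsElliptic] [W.IsGloballyMinimal] (C : VariableChange ℚ)
    (hCV : C • W.quadraticTwist ((-1) ^ (p / 2) * p) = V)
    (T : Finset (HeightOneSpectrum (𝓞 ℚ)))
    (hpT : (Rat.HeightOneSpectrum.primesEquiv (R := 𝓞 ℚ)).symm ⟨p, hp.out⟩ ∉ T)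
    (hT : ∀ v : HeightOneSpectrum (𝓞 ℚ), v ≠ (Rat.HeightOneSpectrum.primesEquiv (R := 𝓞 ℚ)).symm ⟨p, hp.out⟩ →
      p ∣ (W.baseChange (v.adicCompletion ℚ)).localTamagawaNumber (v.adicCompletionIntegers ℚ) → v ∈ T)
    (hT1 : ∀ w ∈ T, padicValNat p ((W.baseChange (w.adicCompletion ℚ)).localTamagawaNumber
      (w.adicCompletionIntegers ℚ)) ≤ 1)
    (K₀ : Type) [Field K₀] [NumberField K₀] [IsCyclotomicExtension {p} ℚ K₀]
    [(galRange (K := ℚ) K₀).Normal] (ηq : absoluteGaloisGroup ℚ →* ℤˣ)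
    (hηK : ∀ σ ∈ galRange (K := ℚ) K₀, ηq σ = 1) (hη1 : ηq ≠ 1)
    (κ : ZpExtension ℚ p) (γ : absoluteGaloisGroup ℚ) (hκ : κ.IsCyclotomic) (hγ : κ.IsTopGenerator γ)
    (hγK : γ ∈ galRange (K := ℚ) K₀) (hγc : IsCyclotomicVariable p γ)
    (D : EtaSignedSelmerDualData V κ K₀ ℚ_[p] ηq γ 1) (v : ℕ)
    (hv : v + (V.quadraticTwist ((-1) ^ (p / 2) * p)).mordellWeilRank ≤
      ∑ w ∈ T, padicValNat p ((W.baseChange (w.adicCompletion ℚ)).localTamagawaNumber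
        (w.adicCompletionIntegers ℚ))) :
    p ^ v ∣ Nat.card (AddCommGroup.torsion (IwasawaAlgebra.coinvariants p D.X)) := by
  have hp2 : p ≠ 2 := by omega
  -- (1) `rank_{ℤ_p} X_η/TX_η = r` (g3's `T`-semisimplicity)
  obtain ⟨hfin, htor⟩ :=
    EtaSignedSelmerDualData.finite_isTorsion_of_thm22 h22 hηK hp2 hgood hap hκ hγ hγK D
  haveI : Module.Finite (IwasawaAlgebra p) D.X := hfin
  obtain ⟨g, hg⟩ := (charIdeal_isPrincipal_holds p D.X).principal
  have hg' : D.charIdeal = Ideal.span {g} := hg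
  obtain ⟨hord, hkfin⟩ :=
    order_eq_twistRank_and_finite_ker_bockstein_of_namedFacts_of_certV_of_coeff_ne_zero h12 h13 h22
      h41 hp5 hgood hap hsurj (fun f hf => hcertV f hf) hf ϖ hϖ Lη hL hne K₀ ηq hηK hη1 κ γ hκ hγ hγK
      hγc D hg'
  have hrank : coinvariantsRank p D.X = (V.quadraticTwist ((-1) ^ (p / 2) * p)).mordellWeilRank := by
    have h := (IwasawaAlgebra.order_charGenerator_eq_coinvariantsRank_iff_finite_ker_bockstein p D.X htor
      g hg').mpr hkfin
    rw [hord] at h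
    exact (ENat.coe_inj.mp h).symm
  -- (2) `D.X` is Pontryagin dual to `Sel⁺(W/ℚ_∞)` in `W`-coordinates; `X/TX ≅ Hom(Sel⁺_∞^Γ, ℚ/ℤ)`
  obtain ⟨toDualW, hdualW⟩ :=
    TamagawaRoad.exists_isDualPair_strictSigned_of_eta W C hp2 hCV hηK hη1 hκ hγ hγK D
  obtain ⟨Ψ, -⟩ := hdualW.exists_coinvariants_addEquiv
  -- (3) Pontryagin bookkeeping over `ℤ_p`
  letI : Module ℤ_[p] (coinvariants p D.X) :=
    Module.compHom _ (algebraMap ℤ_[p] (IwasawaAlgebra p))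
  haveI : Module.Finite ℤ_[p] (coinvariants p D.X) := finite_int_coinvariants p D.X
  have hfr : Module.finrank ℤ_[p] (coinvariants p D.X) =
      (V.quadraticTwist ((-1) ^ (p / 2) * p)).mordellWeilRank :=
    (coinvariantsRank_eq_finrank_int D.X).symm.trans hrank
  obtain ⟨hfinS, hle⟩ := TamagawaRoad.natCard_torsionBy_le_pow_finrank_mul_natCard_torsion p Ψ
  obtain ⟨-, j, hj⟩ := TamagawaRoad.exists_natCard_torsion_eq_pow p (N := coinvariants p D.X)
  rw [hfr, hj, ← pow_add] at hle
  -- (4) the `W`-side Poitou–Tate count at level `p`, read on `Sel⁺(W/ℚ_∞)^Γ[p]`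
  have hcount :=
    TamagawaRoad.prod_pow_padicValNat_localTamagawaNumber_dvd_natCard_localPreimage_inf_torsionBy W p κ 1
      le_rfl hp2 hκ C V hCV hgood hap hPT T hpT hT hT1
  rw [TamagawaRoad.natCard_localPreimage_inf_torsionBy_eq κ W hp2 C V hCV hgood hap hγ 1, pow_one,
    Finset.prod_pow_eq_pow_sum] at hcount
  -- assemble: `p^Σ ∣ #S[p] ≤ p^(r + j)`
  haveI := hfinS
  have hpos : 0 < Nat.card ↥((↥(endInvariants (conjStrictSignedSelmerInfty W κ ℚ_[p] 1 γ - 1)))[(p : ℤ)]) :=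
    Nat.card_pos
  have h1 := (Nat.le_of_dvd hpos hcount).trans hle
  have h2 := (Nat.pow_le_pow_iff_right hp.out.one_lt).mp h1
  rw [hj]
  exact pow_dvd_pow p (by omega)

/-! ## §2 (E⁺_η) at the pair — the Tamagawa road -/

/-- **THE TAMAGAWA ROAD: (E⁺_η) AT A TOWER-ONTO PAIR OF ANY RANK from the Tamagawa numbers of the
`p*`-partner.** GRANTED Kobayashi's Thm. 1.2 / 1.3 / 2.2(η) / 4.1(η), Kitajima–Otsuki's Thm. 1.3 at
`η` and Poitou–Tate duality (NAMED facts), on a good `a_p = 0` pair with `p ≥ 5`, `ρ_{V,p^m}` onto,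
the `V`-certificate, the `p*`-partner `W` with a finite `T ∌ (p)` containing every `ℓ ≠ p` with
`p ∣ c_ℓ(W)` and `ord_p c_ℓ(W) ≤ 1` on `T`, ONE integer `v` with the ANALYTIC certificate
`p^{v+1} ∤ coeff_r L_p⁺(V,η,T)` (`r = rank V^{(p*)}(ℚ)`) and the ARITHMETIC input
**`v + r ≤ ∑_{ℓ ∈ T} ord_p c_ℓ(W)`**: (E⁺_η)(V, p). p505261's road with its torsion slot filled by
§1. CONDITIONAL; closes nothing class-wide; certifies no row in the kernel (the analytic certificate
is kit evidence). [cite: Kobayashi2003, Thm. 2.2 (p. 5), Thm. 4.1 and §4 (p. 8), Thm. 9.3 (pp. 26–27)]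
[cite: KitajimaOtsuki2018, Thm. 1.3] [cite: MilneADT2006, Ch. I, Thm. 4.10]
[cite: CoatesSchneiderSujatha2003, §3 (30)–(31)] [cite: GreenbergLNM1716, §3–§4] -/
theorem quadraticBranchPlusEtaLowerInclusionAt_of_namedFacts_of_certV_of_poitouTate_of_tamagawa
    (h12 : Kobayashi2003.thm12_signedSelmerDual_finite_torsion)
    (h13 : Kobayashi2003.thm41_signedCharIdeal_divisibility)
    (h22 : Kobayashi2003.thm22_etaSignedSelmerDual_finite_torsion)
    (h41 : Kobayashi2003.thm41_plusEtaCharIdeal_dvd)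
    (hKO : KitajimaOtsuki2018.mainThm13_etaSignedSelmerDual_noFiniteSubmodule)
    (hPT : poitouTate_selmerStructure_duality_real ℚ)
    (hp5 : 5 ≤ p) (hgood : V.HasGoodReductionAtPrime p) (hap : V.frobeniusTrace p = 0)
    (hsurj : ∀ m : ℕ, V.HasSurjectiveModNGaloisRep (p ^ m : ℕ))
    (hcertV : ∀ {N : ℕ} [NeZero N] (f : CuspForm (Gamma0 N) 2), IsNewformOf V f →
      ∃ L : IwasawaAlgebra p, Kobayashi2003.IsSignedPAdicLFunction f p 1 L ∧
        IsUnit (PowerSeries.coeff V.mordellWeilRank L))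
    (W : WeierstrassCurve ℚ) [W.IsElliptic] [W.IsGloballyMinimal] (C : VariableChange ℚ)
    (hCV : C • W.quadraticTwist ((-1) ^ (p / 2) * p) = V)
    (T : Finset (HeightOneSpectrum (𝓞 ℚ)))
    (hpT : (Rat.HeightOneSpectrum.primesEquiv (R := 𝓞 ℚ)).symm ⟨p, hp.out⟩ ∉ T)
    (hT : ∀ v : HeightOneSpectrum (𝓞 ℚ), v ≠ (Rat.HeightOneSpectrum.primesEquiv (R := 𝓞 ℚ)).symm ⟨p, hp.out⟩ →
      p ∣ (W.baseChange (v.adicCompletion ℚ)).localTamagawaNumber (v.adicCompletionIntegers ℚ) → v ∈ T)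
    (hT1 : ∀ w ∈ T, padicValNat p ((W.baseChange (w.adicCompletion ℚ)).localTamagawaNumber
      (w.adicCompletionIntegers ℚ)) ≤ 1)
    (v : ℕ)
    (hv : v + (V.quadraticTwist ((-1) ^ (p / 2) * p)).mordellWeilRank ≤
      ∑ w ∈ T, padicValNat p ((W.baseChange (w.adicCompletion ℚ)).localTamagawaNumber
        (w.adicCompletionIntegers ℚ)))
    (han : ∀ {N : ℕ} [NeZero N] {f : CuspForm (Gamma0 N) 2}, IsNewformOf V f →
      ∀ (ϖ : ℚ), (if Even (p / 2) then (ϖ : ℝ) * V.realPeriodRat = plusPeriod f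
          else (ϖ : ℝ) * V.imaginaryPeriodRat = minusPeriod f) →
      ∀ (Lη : IwasawaAlgebra p), IsQuadraticBranchPlusLFunction f p ϖ Lη →
        ¬ (p : ℤ_[p]) ^ (v + 1) ∣
          PowerSeries.coeff (V.quadraticTwist ((-1) ^ (p / 2) * p)).mordellWeilRank Lη) :
    QuadraticBranchPlusEtaLowerInclusionAt V p := by
  intro K₀ _ _ _ _ ηq hηK hη1 N _ f hp2 hgood' hap' hf ϖ hϖ Lη hL κ γ hκ hγ hγK hγc D
  obtain ⟨hfin, htor⟩ :=
    EtaSignedSelmerDualData.finite_isTorsion_of_thm22 h22 hηK hp2 hgood' hap' hκ hγ hγK D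
  haveI : Module.Finite (IwasawaAlgebra p) D.X := hfin
  obtain ⟨g, hg⟩ := (charIdeal_isPrincipal_holds p D.X).principal
  have hg' : D.charIdeal = Ideal.span {g} := hg
  -- Kato side: `g ∣ Lη`
  obtain ⟨-, hup⟩ := EtaSignedSelmerDualData.thm41_plus_of_facts h22 h41 hηK hη1 hp2 hgood' hap' hf
    ϖ hϖ Lη hL hκ hγ hγK hγc D
  have hgL : g ∣ Lη := by
    have h := hup hsurj
    rw [hg', Ideal.span_singleton_le_span_singleton] at h
    exact h
  have hanL := han hf ϖ hϖ Lη hL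
  have hne : PowerSeries.coeff (V.quadraticTwist ((-1) ^ (p / 2) * p)).mordellWeilRank Lη ≠ 0 :=
    fun h0 => hanL (by rw [h0]; exact dvd_zero _)
  -- rank bound, leading coefficient, torsion divisibility
  have hXg := X_pow_twistRank_dvd_etaCharGenerator_of_namedFacts_of_certV h12 h13 h22 hp5 hgood hap
    hsurj (fun f hf => hcertV f hf) hf K₀ ηq hηK hη1 κ γ hκ hγ hγK hγc D hg'
  obtain ⟨u, hu⟩ := coeff_twistRank_etaCharGenerator_eq_unit_mul_card_coker_bockstein h12 h13 h22 h41
    hKO hp5 hgood hap hsurj (fun f hf => hcertV f hf) hf ϖ hϖ Lη hL hne K₀ ηq hηK hη1 κ γ hκ hγ hγK hγc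
    D hg'
  obtain ⟨-, hdvd⟩ := ker_bockstein_eq_bot_and_natCard_torsion_coinvariants_dvd h12 h13 h22 h41 hKO
    hp5 hgood hap hsurj (fun f hf => hcertV f hf) hf ϖ hϖ Lη hL hne K₀ ηq hηK hη1 κ γ hκ hγ hγK hγc D
  -- the Tamagawa road (§1)
  have htors := pow_dvd_natCard_torsion_coinvariants_of_namedFacts_of_poitouTate_of_tamagawa h12 h13
    h22 h41 hPT hp5 hgood hap hsurj (fun f hf => hcertV f hf) hf ϖ hϖ Lη hL hne W C hCV T hpT hT hT1
    K₀ ηq hηK hη1 κ γ hκ hγ hγK hγc D v hv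
  have halg : (p : ℤ_[p]) ^ v ∣
      PowerSeries.coeff (V.quadraticTwist ((-1) ^ (p / 2) * p)).mordellWeilRank g := by
    rw [hu]
    obtain ⟨c, hc⟩ := htors.trans hdvd
    refine Dvd.dvd.mul_left ?_ _
    rw [hc, Nat.cast_mul, Nat.cast_pow]
    exact dvd_mul_right _ _
  -- squeeze
  have heq : Ideal.span {g} = Ideal.span {Lη} :=
    span_singleton_eq_of_X_pow_dvd_of_dvd_of_pow_dvd_coeff hXg hgL halg hanL
  rw [← heq, ← hg']

/-! ## §3 The even main conjecture at `η` in full at the pair -/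

/-- **(E⁺_η) ∧ (C1⁺_η) — Kobayashi's even main conjecture at `η` IN FULL at a tower-onto pair, from
the Tamagawa road.** Same hypotheses as
`quadraticBranchPlusEtaLowerInclusionAt_of_namedFacts_of_certV_of_poitouTate_of_tamagawa`; the equality
`Char(X⁺(V/K_∞)^η) = (L_p⁺(V,η,X))` follows from the lower inclusion, Thm. 2.2 / 4.1 at `η` and
surjectivity (`quadraticBranchPlusEtaMainConjectureAt_of_facts_of_surjective_of_etaLowerInclusion`).
CONDITIONAL; closes nothing class-wide; certifies no row in the kernel.
[cite: Kobayashi2003, Thm. 2.2 (p. 5), §4 Even main conjecture and Thm. 4.1 (p. 8)]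
[cite: KitajimaOtsuki2018, Thm. 1.3] [cite: MilneADT2006, Ch. I, Thm. 4.10] -/
theorem quadraticBranchPlusEta_lowerInclusion_and_mainConjectureAt_of_namedFacts_of_poitouTate_of_tamagawa
    (h12 : Kobayashi2003.thm12_signedSelmerDual_finite_torsion)
    (h13 : Kobayashi2003.thm41_signedCharIdeal_divisibility)
    (h22 : Kobayashi2003.thm22_etaSignedSelmerDual_finite_torsion)
    (h41 : Kobayashi2003.thm41_plusEtaCharIdeal_dvd)
    (hKO : KitajimaOtsuki2018.mainThm13_etaSignedSelmerDual_noFiniteSubmodule)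
    (hPT : poitouTate_selmerStructure_duality_real ℚ)
    (hp5 : 5 ≤ p) (hgood : V.HasGoodReductionAtPrime p) (hap : V.frobeniusTrace p = 0)
    (hsurj : ∀ m : ℕ, V.HasSurjectiveModNGaloisRep (p ^ m : ℕ))
    (hcertV : ∀ {N : ℕ} [NeZero N] (f : CuspForm (Gamma0 N) 2), IsNewformOf V f →
      ∃ L : IwasawaAlgebra p, Kobayashi2003.IsSignedPAdicLFunction f p 1 L ∧
        IsUnit (PowerSeries.coeff V.mordellWeilRank L))
    (W : WeierstrassCurve ℚ) [W.IsElliptic] [W.IsGloballyMinimal] (C : VariableChange ℚ)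
    (hCV : C • W.quadraticTwist ((-1) ^ (p / 2) * p) = V)
    (T : Finset (HeightOneSpectrum (𝓞 ℚ)))
    (hpT : (Rat.HeightOneSpectrum.primesEquiv (R := 𝓞 ℚ)).symm ⟨p, hp.out⟩ ∉ T)
    (hT : ∀ v : HeightOneSpectrum (𝓞 ℚ), v ≠ (Rat.HeightOneSpectrum.primesEquiv (R := 𝓞 ℚ)).symm ⟨p, hp.out⟩ →
      p ∣ (W.baseChange (v.adicCompletion ℚ)).localTamagawaNumber (v.adicCompletionIntegers ℚ) → v ∈ T)
    (hT1 : ∀ w ∈ T, padicValNat p ((W.baseChange (w.adicCompletion ℚ)).localTamagawaNumber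
      (w.adicCompletionIntegers ℚ)) ≤ 1)
    (v : ℕ)
    (hv : v + (V.quadraticTwist ((-1) ^ (p / 2) * p)).mordellWeilRank ≤
      ∑ w ∈ T, padicValNat p ((W.baseChange (w.adicCompletion ℚ)).localTamagawaNumber
        (w.adicCompletionIntegers ℚ)))
    (han : ∀ {N : ℕ} [NeZero N] {f : CuspForm (Gamma0 N) 2}, IsNewformOf V f →
      ∀ (ϖ : ℚ), (if Even (p / 2) then (ϖ : ℝ) * V.realPeriodRat = plusPeriod f
          else (ϖ : ℝ) * V.imaginaryPeriodRat = minusPeriod f) →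
      ∀ (Lη : IwasawaAlgebra p), IsQuadraticBranchPlusLFunction f p ϖ Lη →
        ¬ (p : ℤ_[p]) ^ (v + 1) ∣
          PowerSeries.coeff (V.quadraticTwist ((-1) ^ (p / 2) * p)).mordellWeilRank Lη) :
    QuadraticBranchPlusEtaLowerInclusionAt V p ∧ QuadraticBranchPlusEtaMainConjectureAt V p := by
  have hE := quadraticBranchPlusEtaLowerInclusionAt_of_namedFacts_of_certV_of_poitouTate_of_tamagawa h12
    h13 h22 h41 hKO hPT hp5 hgood hap hsurj (fun f hf => hcertV f hf) W C hCV T hpT hT hT1 v hv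
    (fun hf => han hf)
  exact ⟨hE, quadraticBranchPlusEtaMainConjectureAt_of_facts_of_surjective_of_etaLowerInclusion h22 h41
    hsurj hE⟩

end Summit.BirchSwinnertonDyer.BirchSwinnertonDyer.Theorems

end
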